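import Literature.NumberTheory.GaloisRepresentations.GalLayerSystemSES
import HarnessLib

/-!
# Morphisms from a `U_E`-trivial object into `lim→ D` factor through the layer `D.obj E`

Topic `NumberTheory/GaloisRepresentations`; namespace `Literature.NumberTheory.GaloisRepresentations.GalLayerData`.
Definitions with bodies and theorems; no named fact, no instance, no `sorry`.  Sequel to door-c5's `GalLayerSystemLayers`
(`D.layerEquiv : (lim D)^{U_E} ≃ D.V E`, Galois descent `exists_of_eq_of_forall_mem`) and `GalLayerSystemHom` (`φ.limitHom`).

For a Galois layer system `D` of a number field `F` (`E ↦ D.V E` with `Gal(E/F)`-action, e.g. `E ↦ Eˣ`, `E ↦ J_E`,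
`E ↦ C_E`), a layer `E` and an object `X` of door-c4's `C_Γ = DiscreteRepCat ℤ Γ_F` on which `U_E = Gal(F̄/E)` acts
trivially, every `C_Γ`-morphism `f : X ⟶ lim→ D` takes `U_E`-invariant values, hence factors UNIQUELY through the layer:
`f = [·]_E ∘ φ` for an additive `φ : X → D.V E` equivariant along `Γ_F → Gal(E/F)` (`layerLift`, `of_layerLift`,
`layerLift_smul`); conversely every such `φ` defines a morphism (`ofLayerHom`), and the two constructions are inverse
(`layerLift_ofLayerHom`, `ofLayerHom_layerLift`).  `layerLift` is natural in morphisms of systems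
(`layerLift_comp_limitHom`: `layerLift (f ≫ lim ψ) = ψ_E ∘ layerLift f`).  This is the entry point of the idèle readout
of the presentation road (door-c6 g16, FINDING §5 (R-def)(b)): an equivariant `f : N₁ ⟶ J̄` out of the `U_{E₀}`-trivial
kernel `N₁` of a presentation IS a `Gal(E₀/F)`-equivariant homomorphism `N₁ → J_{E₀}`
("`Hom_{C_Γ}(N₁, J̄) = Hom_{Gal(E₀/F)}(N₁, J_{E₀})`", idèle Galois descent, Tate VII §8 Prop. 8.1).

References: Cassels–Fröhlich (Tate) VII §8 Prop. 8.1, §9.7; Harari, *Galois Cohomology and Class Field Theory* §13.1.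
-/

noncomputable section

open CategoryTheory
open Field (absoluteGaloisGroup)
open Literature.Algebra.Homology

namespace Literature.NumberTheory.GaloisRepresentations

open IdeleClassBar

namespace GalLayerData

variable {F : Type} [Field F] (D : GalLayerData F) (E : GalLayer F)
variable {X : DiscreteRepCat ℤ (absoluteGaloisGroup F)}

/-! ## §1 Values of a morphism out of a `U_E`-trivial object lie in the layer `E` -/

/-- **A `C_Γ`-morphism out of a `U_E`-trivial object takes values in `[D.V E]_E ⊆ lim→ D`** (its values are
`U_E`-invariant; Galois descent `exists_of_eq_of_forall_mem`). [cite: CasselsFrohlichANT1967, Ch. VII §8 Prop. 8.1] -/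
theorem exists_of_eq_hom (hX : ∀ σ ∈ E.openNormalSubgroup, ∀ x : X.obj.V, X.obj.ρ σ x = x)
    (f : X ⟶ D.toSystem.toD) (x : X.obj.V) :
    ∃ y : D.V E, D.toSystem.of E y = f.hom.hom x :=
  D.toSystem.exists_of_eq_of_forall_mem E _ fun σ hσ => by
    have h := Rep.hom_comm_apply f.hom σ x
    rw [hX σ hσ x] at h
    exact h.symm

/-- **The layer lift `φ = layerLift f : X → D.V E`** of a `C_Γ`-morphism `f : X ⟶ lim→ D` out of a `U_E`-trivial `X`
(`[φ x]_E = f x`). [cite: CasselsFrohlichANT1967, Ch. VII §8 Prop. 8.1] -/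
def layerLift (hX : ∀ σ ∈ E.openNormalSubgroup, ∀ x : X.obj.V, X.obj.ρ σ x = x) (f : X ⟶ D.toSystem.toD) :
    X.obj.V →+ D.V E where
  toFun x := Classical.choose (D.exists_of_eq_hom E hX f x)
  map_zero' := D.toSystem.of_injective E (by
    rw [Classical.choose_spec (D.exists_of_eq_hom E hX f 0), map_zero, map_zero])
  map_add' x x' := D.toSystem.of_injective E (by
    rw [Classical.choose_spec (D.exists_of_eq_hom E hX f (x + x')), map_add, map_add,
      Classical.choose_spec (D.exists_of_eq_hom E hX f x), Classical.choose_spec (D.exists_of_eq_hom E hX f x')])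

/-- `[layerLift f x]_E = f x`. [cite: CasselsFrohlichANT1967, Ch. VII §8 Prop. 8.1] -/
@[simp] theorem of_layerLift (hX : ∀ σ ∈ E.openNormalSubgroup, ∀ x : X.obj.V, X.obj.ρ σ x = x)
    (f : X ⟶ D.toSystem.toD) (x : X.obj.V) :
    D.toSystem.of E (D.layerLift E hX f x) = f.hom.hom x :=
  Classical.choose_spec (D.exists_of_eq_hom E hX f x)

/-- `layerLift f x = y ↔ [y]_E = f x`. [cite: CasselsFrohlichANT1967, Ch. VII §8 Prop. 8.1] -/
theorem layerLift_eq_iff (hX : ∀ σ ∈ E.openNormalSubgroup, ∀ x : X.obj.V, X.obj.ρ σ x = x)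
    (f : X ⟶ D.toSystem.toD) (x : X.obj.V) (y : D.V E) :
    D.layerLift E hX f x = y ↔ D.toSystem.of E y = f.hom.hom x := by
  constructor
  · rintro rfl
    exact D.of_layerLift E hX f x
  · intro h
    exact D.toSystem.of_injective E ((D.of_layerLift E hX f x).trans h.symm)

/-- **`layerLift f` is equivariant along `Γ_F → Gal(E/F)`**: `φ (σ x) = σ|_E (φ x)`.
[cite: CasselsFrohlichANT1967, Ch. VII §8 Prop. 8.1] -/
theorem layerLift_smul (hX : ∀ σ ∈ E.openNormalSubgroup, ∀ x : X.obj.V, X.obj.ρ σ x = x)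
    (f : X ⟶ D.toSystem.toD) (σ : absoluteGaloisGroup F) (x : X.obj.V) :
    D.layerLift E hX f (X.obj.ρ σ x) = D.ρ E (E.restrictHom σ) (D.layerLift E hX f x) := by
  rw [layerLift_eq_iff]
  change D.toSystem.of E ((D.toSystem.obj E).ρ (E.restrictHom σ) (D.layerLift E hX f x)) = _
  rw [← GalLayerSystem.rep_of, of_layerLift]
  exact (Rep.hom_comm_apply f.hom σ x).symm

/-- `layerLift` is additive in `f`. [cite: CasselsFrohlichANT1967, Ch. VII §8 Prop. 8.1] -/
theorem layerLift_add (hX : ∀ σ ∈ E.openNormalSubgroup, ∀ x : X.obj.V, X.obj.ρ σ x = x)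
    (f g : X ⟶ D.toSystem.toD) (x : X.obj.V) :
    D.layerLift E hX (f + g) x = D.layerLift E hX f x + D.layerLift E hX g x := by
  rw [layerLift_eq_iff, map_add, of_layerLift, of_layerLift]
  rfl

/-- `layerLift 0 = 0`. [cite: CasselsFrohlichANT1967, Ch. VII §8 Prop. 8.1] -/
theorem layerLift_zero (hX : ∀ σ ∈ E.openNormalSubgroup, ∀ x : X.obj.V, X.obj.ρ σ x = x) (x : X.obj.V) :
    D.layerLift E hX (0 : X ⟶ D.toSystem.toD) x = 0 := by
  rw [layerLift_eq_iff, map_zero]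
  rfl

/-- **Naturality in the system**: `layerLift (f ≫ lim ψ) = ψ_E ∘ layerLift f` for a morphism of layer systems `ψ : D → D'`
(e.g. `unitsToIdele`, `ideleToClass`). [cite: CasselsFrohlichANT1967, Ch. VII §9.7] -/
theorem layerLift_comp_limitHom {D' : GalLayerData F} (ψ : D.Hom D')
    (hX : ∀ σ ∈ E.openNormalSubgroup, ∀ x : X.obj.V, X.obj.ρ σ x = x) (f : X ⟶ D.toSystem.toD) (x : X.obj.V) :
    D'.layerLift E hX (f ≫ ψ.limitHom) x = ψ.app E (D.layerLift E hX f x) := by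
  rw [layerLift_eq_iff, ← GalLayerData.Hom.limitMap_of, of_layerLift]
  rfl

/-- **A morphism out of a `U_E`-trivial object vanishes iff its layer lift does.** [cite: CasselsFrohlichANT1967, Ch. VII §8 Prop. 8.1] -/
theorem layerLift_apply_eq_zero_iff (hX : ∀ σ ∈ E.openNormalSubgroup, ∀ x : X.obj.V, X.obj.ρ σ x = x)
    (f : X ⟶ D.toSystem.toD) (x : X.obj.V) :
    D.layerLift E hX f x = 0 ↔ f.hom.hom x = 0 := by
  rw [layerLift_eq_iff, map_zero]
  exact eq_comm

/-! ## §2 Conversely: an equivariant `φ : X → D.V E` defines a morphism `X ⟶ lim→ D` -/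

/-- **The `C_Γ`-morphism `x ↦ [φ x]_E` attached to an additive `φ : X → D.V E` equivariant along `Γ_F → Gal(E/F)`.**
[cite: CasselsFrohlichANT1967, Ch. VII §8 Prop. 8.1, §9.7] -/
def ofLayerHom (φ : X.obj.V →+ D.V E)
    (hφ : ∀ (σ : absoluteGaloisGroup F) (x : X.obj.V), φ (X.obj.ρ σ x) = D.ρ E (E.restrictHom σ) (φ x)) :
    X ⟶ D.toSystem.toD :=
  letI : Module ℤ X.obj.V := X.obj.hV2
  ObjectProperty.homMk (Rep.ofHom
    ⟨{ toFun := fun x => D.toSystem.of E (φ x)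
       map_add' := fun x x' => by rw [map_add, map_add]
       map_smul' := fun c x => by
         have h := map_intCast_smul ((D.toSystem.of E).comp φ) ℤ ℤ c x
         simpa only [Int.cast_id, AddMonoidHom.coe_comp, Function.comp_apply, RingHom.id_apply] using h },
      fun σ => LinearMap.ext fun x => by
        change D.toSystem.of E (φ (X.obj.ρ σ x)) = D.toSystem.rep σ (D.toSystem.of E (φ x))
        rw [hφ, GalLayerSystem.rep_of]⟩)

/-- Unfolding `ofLayerHom`: `(ofLayerHom φ) x = [φ x]_E`. [cite: CasselsFrohlichANT1967, Ch. VII §8 Prop. 8.1] -/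
@[simp] theorem ofLayerHom_apply (φ : X.obj.V →+ D.V E)
    (hφ : ∀ (σ : absoluteGaloisGroup F) (x : X.obj.V), φ (X.obj.ρ σ x) = D.ρ E (E.restrictHom σ) (φ x))
    (x : X.obj.V) : (D.ofLayerHom E φ hφ).hom.hom x = D.toSystem.of E (φ x) := rfl

/-- `layerLift (ofLayerHom φ) = φ`. [cite: CasselsFrohlichANT1967, Ch. VII §8 Prop. 8.1] -/
theorem layerLift_ofLayerHom (hX : ∀ σ ∈ E.openNormalSubgroup, ∀ x : X.obj.V, X.obj.ρ σ x = x)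
    (φ : X.obj.V →+ D.V E)
    (hφ : ∀ (σ : absoluteGaloisGroup F) (x : X.obj.V), φ (X.obj.ρ σ x) = D.ρ E (E.restrictHom σ) (φ x))
    (x : X.obj.V) : D.layerLift E hX (D.ofLayerHom E φ hφ) x = φ x := by
  rw [layerLift_eq_iff, ofLayerHom_apply]

/-- `ofLayerHom (layerLift f) = f`: **`Hom_{C_Γ}(X, lim→ D) = Hom_{Gal(E/F)}(X, D.V E)` for `U_E`-trivial `X`.**
[cite: CasselsFrohlichANT1967, Ch. VII §8 Prop. 8.1] -/
theorem ofLayerHom_layerLift (hX : ∀ σ ∈ E.openNormalSubgroup, ∀ x : X.obj.V, X.obj.ρ σ x = x)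
    (f : X ⟶ D.toSystem.toD) :
    D.ofLayerHom E (D.layerLift E hX f) (D.layerLift_smul E hX f) = f := by
  letI : Module ℤ X.obj.V := X.obj.hV2
  exact ObjectProperty.hom_ext _ (Rep.hom_ext (Representation.IntertwiningMap.ext
    (LinearMap.ext fun x => D.of_layerLift E hX f x)))

end GalLayerData

end Literature.NumberTheory.GaloisRepresentations

end
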